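import Literature.NumberTheory.Automorphic.AutomorphicSpectrum
import Literature.NumberTheory.Automorphic.AdelicSecondCountable
import Mathlib.MeasureTheory.Measure.SeparableMeasure
import Mathlib.Analysis.InnerProductSpace.l2Space
import HarnessLib

/-!
# `L²` of an automorphic quotient is separable; Hilbert bases are countable
(Reed–Simon, *Methods of Modern Mathematical Physics I* (1972), Thm. II.7: a Hilbert space is
separable iff it has a countable orthonormal basis; Gelbart (1975), proof of Prop. 9.6, p. 122:
"for any complete orthonormal system `φ_i` in `L₀²(X)`")

Topic `NumberTheory/Automorphic`; theorems only (no definition, no named fact, no instance visible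
to importers). The trace-formula files of the tree state their Hilbert–Schmidt identities for
Hilbert bases with a *countable* index (`[Countable ι]`: `QuaternionUnitsTraceFormula`,
`AutomorphicQuotientKernelCompact`/`Noncompact`/`Diagonal`, `GLnSupercuspTypeHilbertSchmidt`), the
countability entering through monotone convergence (`lintegral_tsum`). This file discharges that
side condition once and for all:

* `Orthonormal.countable_index_of_separableSpace` — **in a separable inner product space every
  orthonormal family has a countable index** (distinct members are at distance `√2`, so the balls
  of radius `1/2` about them are disjoint non-empty open sets; Mathlib
  `Pairwise.countable_of_isOpen_disjoint`; the version for orthonormal *sets* is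
  `Orthonormal.countable_of_separableSpace` of `Literature/Analysis/OperatorTheory/JointEigenbasis`,
  which imports all of Mathlib and is not imported here);
  `HilbertBasis.countable_index_of_separableSpace`.
* `AdelicGroupData.secondCountableTopology_L2` — for an adelic group datum with `G(𝔸_K)` second
  countable and a finite measure `μ` on the automorphic quotient, **`L²(G(𝔸_K) ⧸ A_G G(K), μ)` is
  second countable** (Mathlib `Lp.SecondCountableTopology`: the quotient is second countable, hence
  its Borel σ-algebra countably generated and `μ` separable).
* `AdelicGroupData.countable_of_hilbertBasis_L2`, `AdelicGroupData.countable_of_hilbertBasis_submodule`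
  — every Hilbert basis of `L²` or of a subspace of `L²` has a countable index;
  `AdelicGroupData.exists_countable_hilbertBasis_L2` — a Hilbert basis with countable index exists.
* `GLn.secondCountableTopology_L2`, `GLn.countable_of_hilbertBasis_L2`,
  `GLn.exists_countable_hilbertBasis_L2` — the case `GL_n` (`secondCountableTopology_gl_adelic`).

## References

* M. Reed, B. Simon, *Methods of Modern Mathematical Physics I: Functional Analysis* (1972),
  Thm. II.7 [ReedSimon1972].
* S. Gelbart, *Automorphic forms on adele groups* (1975), Prop. 9.6 (proof, p. 122) [Gelbart1975].
-/

noncomputable section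

open MeasureTheory Filter Topology
open scoped ENNReal InnerProductSpace

/-! ### Orthonormal families in separable spaces are countable -/

section Orthonormal

variable {𝕜 E : Type*} [RCLike 𝕜] [NormedAddCommGroup E] [InnerProductSpace 𝕜 E]

/-- **In a separable inner product space every orthonormal family has a countable index**
(Reed–Simon I, Thm. II.7): two distinct members `v i`, `v j` satisfy `‖v i - v j‖ = √2 > 1`, so
the open balls `B(v i, 1/2)` are pairwise disjoint and non-empty, and a separable space has only
countably many such (Mathlib `Pairwise.countable_of_isOpen_disjoint`). [cite: ReedSimon1972, Thm. II.7] -/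
theorem Orthonormal.countable_index_of_separableSpace [TopologicalSpace.SeparableSpace E] {ι : Type*}
    {v : ι → E} (hv : Orthonormal 𝕜 v) : Countable ι := by
  have hfar : ∀ i j, i ≠ j → 1 < ‖v i - v j‖ := by
    intro i j hij
    have h0 : ⟪v i, v j⟫_𝕜 = 0 := hv.2 hij
    have hsq : ‖v i - v j‖ ^ 2 = 2 := by
      rw [@norm_sub_sq 𝕜, hv.1 i, hv.1 j, h0]
      norm_num
    nlinarith [norm_nonneg (v i - v j), hsq]
  refine Pairwise.countable_of_isOpen_disjoint (s := fun i => Metric.ball (v i) (1 / 2))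
    (fun i j hij => Metric.ball_disjoint_ball ?_) (fun i => Metric.isOpen_ball)
    fun i => ⟨v i, Metric.mem_ball_self (by norm_num)⟩
  rw [dist_eq_norm]
  linarith [hfar i j hij]

/-- **A Hilbert basis of a separable space has a countable index** (Reed–Simon I, Thm. II.7).
[cite: ReedSimon1972, Thm. II.7] -/
theorem HilbertBasis.countable_index_of_separableSpace [TopologicalSpace.SeparableSpace E] {ι : Type*}
    (b : HilbertBasis ι 𝕜 E) : Countable ι :=
  b.orthonormal.countable_index_of_separableSpace

end Orthonormal

namespace Literature.NumberTheory.Automorphic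

/-! ### `L²` of an automorphic quotient -/

namespace AdelicGroupData

universe u

variable {K : Type} [Field K] [NumberField K] (𝒢 : AdelicGroupData.{u} K)
  [SecondCountableTopology 𝒢.Adelic] (μ : Measure 𝒢.automorphicQuotient) [IsFiniteMeasure μ]

/-- The automorphic quotient of a datum with second countable `G(𝔸_K)` is second countable
(Mathlib: quotients of second countable groups by subgroups). [folklore] -/
theorem secondCountableTopology_automorphicQuotient :
    SecondCountableTopology 𝒢.automorphicQuotient :=
  inferInstanceAs (SecondCountableTopology (𝒢.Adelic ⧸ 𝒢.quotientSubgroup))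

/-- **`L²(G(𝔸_K) ⧸ A_G G(K), μ)` is second countable** for a finite measure `μ` on the automorphic
quotient of a datum with second countable `G(𝔸_K)` (Mathlib `Lp.SecondCountableTopology`: the
Borel σ-algebra of the second countable quotient is countably generated, so the finite measure `μ`
is separable). [cite: ReedSimon1972, Thm. II.7] -/
theorem secondCountableTopology_L2 : SecondCountableTopology (𝒢.L2 μ) := by
  haveI := secondCountableTopology_automorphicQuotient 𝒢
  haveI : Fact ((2 : ℝ≥0∞) ≠ ∞) := ⟨ENNReal.ofNat_ne_top⟩
  change SecondCountableTopology (Lp ℂ 2 μ)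
  infer_instance

/-- Every Hilbert basis of `L²(G(𝔸_K) ⧸ A_G G(K), μ)` has a countable index. [cite: ReedSimon1972, Thm. II.7] -/
theorem countable_of_hilbertBasis_L2 {ι : Type*} (b : HilbertBasis ι ℂ (𝒢.L2 μ)) : Countable ι := by
  haveI := secondCountableTopology_L2 𝒢 μ
  exact b.countable_index_of_separableSpace

/-- Every Hilbert basis of a subspace of `L²(G(𝔸_K) ⧸ A_G G(K), μ)` (e.g. of a closed invariant
subspace such as `L²_cusp`) has a countable index. [cite: ReedSimon1972, Thm. II.7] -/
theorem countable_of_hilbertBasis_submodule (M : Submodule ℂ (𝒢.L2 μ)) {ι : Type*}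
    (b : HilbertBasis ι ℂ M) : Countable ι := by
  haveI := secondCountableTopology_L2 𝒢 μ
  haveI : SecondCountableTopology M := TopologicalSpace.Subtype.secondCountableTopology _
  exact b.countable_index_of_separableSpace

/-- **`L²(G(𝔸_K) ⧸ A_G G(K), μ)` has a Hilbert basis with countable index.** [cite: ReedSimon1972, Thm. II.7] -/
theorem exists_countable_hilbertBasis_L2 :
    ∃ (w : Set (𝒢.L2 μ)) (b : HilbertBasis w ℂ (𝒢.L2 μ)), Countable w ∧ ⇑b = ((↑) : w → 𝒢.L2 μ) := by
  obtain ⟨w, b, hb⟩ := exists_hilbertBasis ℂ (𝒢.L2 μ)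
  exact ⟨w, b, countable_of_hilbertBasis_L2 𝒢 μ b, hb⟩

end AdelicGroupData

/-! ### The case `GL_n` -/

section GLn

open NumberField

variable (n : ℕ) (K : Type) [Field K] [NumberField K]
  (μ : Measure (AdelicGroupData.gl n K).automorphicQuotient) [IsFiniteMeasure μ]

/-- `L²(GL_n(𝔸_K) ⧸ A_G GL_n(K), μ)` is second countable (`secondCountableTopology_gl_adelic`).
[cite: ReedSimon1972, Thm. II.7] -/
theorem GLn.secondCountableTopology_L2 : SecondCountableTopology ((AdelicGroupData.gl n K).L2 μ) := by
  haveI := secondCountableTopology_gl_adelic n K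
  exact AdelicGroupData.secondCountableTopology_L2 (AdelicGroupData.gl n K) μ

variable {n K μ} in
/-- Every Hilbert basis of `L²(GL_n(𝔸_K) ⧸ A_G GL_n(K), μ)` has a countable index.
[cite: ReedSimon1972, Thm. II.7] -/
theorem GLn.countable_of_hilbertBasis_L2 {ι : Type*}
    (b : HilbertBasis ι ℂ ((AdelicGroupData.gl n K).L2 μ)) : Countable ι := by
  haveI := secondCountableTopology_gl_adelic n K
  exact AdelicGroupData.countable_of_hilbertBasis_L2 (AdelicGroupData.gl n K) μ b

variable {n K μ} in
/-- Every Hilbert basis of a subspace of `L²(GL_n(𝔸_K) ⧸ A_G GL_n(K), μ)` has a countable index.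
[cite: ReedSimon1972, Thm. II.7] -/
theorem GLn.countable_of_hilbertBasis_submodule (M : Submodule ℂ ((AdelicGroupData.gl n K).L2 μ))
    {ι : Type*} (b : HilbertBasis ι ℂ M) : Countable ι := by
  haveI := secondCountableTopology_gl_adelic n K
  exact AdelicGroupData.countable_of_hilbertBasis_submodule (AdelicGroupData.gl n K) μ M b

/-- `L²(GL_n(𝔸_K) ⧸ A_G GL_n(K), μ)` has a Hilbert basis with countable index.
[cite: ReedSimon1972, Thm. II.7] -/
theorem GLn.exists_countable_hilbertBasis_L2 :
    ∃ (w : Set ((AdelicGroupData.gl n K).L2 μ)) (b : HilbertBasis w ℂ ((AdelicGroupData.gl n K).L2 μ)),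
      Countable w ∧ ⇑b = ((↑) : w → (AdelicGroupData.gl n K).L2 μ) := by
  haveI := secondCountableTopology_gl_adelic n K
  exact AdelicGroupData.exists_countable_hilbertBasis_L2 (AdelicGroupData.gl n K) μ

end GLn

end Literature.NumberTheory.Automorphic
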